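import Summits.ValiantsHypothesis.ValiantsHypothesis.Theorems.BarrierLeverAnchoredDoorHitsLowerPairsBase
import Summits.ValiantsHypothesis.ValiantsHypothesis.Theorems.BarrierLeverAnchoredDoorHitsLowerPairsMono

/-!
# Route BarrierLever — item `AnchoredDoorHitsLowerPairs` (stmt-ValiantsHypothesis-22510), line `anchored-peeling`:
# THE VERTEX STEP — kernel-checked induction (definition-free), profile `s = 1`

Prover file (cell valiant-natproofs, rung V4, 𝒟-side; seat val-np-p2 gen 10; `--supports stmt-ValiantsHypothesis-22510`; answer to planner
valiant-natproofs-p1 g19's offer STATUS 2026-08-27T23:09:06Z «register STEP-1 as a second open stub of the line»).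

THE MECHANISM (memo HOME/val-np-p2/g10/MEMO-A1-final-valnp2-g10.md §3). For an x-vertex `a`, the profile-1 anchored door satisfies the
exact VERTEX-EXPANSION IDENTITY 𝔄₁ = f' + x_a·(D_λ f' + N_a f') (f' = the door with `a` deleted, D_λ = Σ_e λ_e θ_e ∂/∂θ_e a derivation in the
weights of f' with one free parameter per anchor, N_a = Σ_c θ_{ac} e^{φ_{ac}·x'} ⊗ y_c e^{ψ_{ac}·y}); so the rows of the symbolic layout on a
simplicial pair `(R, C)` are the rows of f' on the deletion complex `R₀ = {S ∈ R : a ∉ S}` together with the «link rows»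
`D_λ ρ'_{S₁} + rows of N_a f'`, `S₁ ∈ lk_a R`.  The VERTEX STEP says that the link rows always complete the deletion rows to a basis:

  VERTEX STEP (the hypothesis `H` below; named `Stmt.stub_vertexStep` in the companion file `…VertexStep.lean`): if the deletion complex `R₀` has independent rows on `C` — witnessed, as in the line's other stubs, by the
  non-vanishing of `symbolicDet 1` on `(R₀, C₀)` for the lower sub-families `C₀ ⊆ C` of size `|R₀|` — then `symbolicDet 1 h r u w ≠ 0`.

It has NO combinatorial side condition (no star counts, any vertex `a` of `R`), so it is a mechanism for exactly the class the line's open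
stub `stub_rigidPairs` has none for; `symbolicDet_one_ne_zero_of_vertexStep'` below is the kernel-checked induction on `r` (base `r ≤ 1` =
the landed `stub_base`) turning it into symbolic non-vanishing for EVERY injective simplicial pair at profile 1, every `h` (`h₀ = 0`), and
`stub_symbolicNonvanishing_of_vertexStep'` transports that to the line's registered `Stmt.stub_symbolicNonvanishing` (any profile, via the
monotonicity `symbolicDet_ne_zero_mono` of `…Mono`).  EVIDENCE (not proof): the profile-1 door is alive on all 5 192 857 isomorphism-type pairs
on ≤ 6 × ≤ 6 vertices and on ≈ 70 000 structured / rigid pairs up to 14 vertices (kit j293283, j292728, j293309, …, `--workitem 22510`), and the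
stronger single-mechanism specialisations of the step (derivation only; c-dependent shifts only; (D_μ + m_ℓ) with 2|Y| parameters) are alive at the
tested vertex of all 27 887 census pairs (kit j293055, j293378) while the pure multiplication step fails on 1 331 of them.

WHAT THIS IS NOT: the vertex step `H` is NOT proved here (definition-free statement; the named `def` lives in `…VertexStep.lean`); nothing on crux stmt-ValiantsHypothesis-14610 or
`VP` versus `VNP`.
-/

set_option linter.dupNamespace false

namespace Summit.ValiantsHypothesis.ValiantsHypothesis.Theorems.BarrierLever.AnchoredPeeling

open Finset MvPolynomial

noncomputable section

section Induction

variable {h : ℕ}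

/-- An injective `Fin r`-family has an image of size `r`. -/
private theorem card_image_univ' {r : ℕ} {u : Fin r → Finset (Fin h)} (hu : Function.Injective u) :
    (Finset.univ.image u).card = r := by
  classical
  rw [Finset.card_image_of_injective _ hu, Finset.card_univ, Fintype.card_fin]

/-- The deletion complex at a vertex lying in some row is strictly smaller. -/
private theorem lt_of_vertexDeletion {r r₀ : ℕ} {u : Fin r → Finset (Fin h)} {u₀ : Fin r₀ → Finset (Fin h)}
    (hu : Function.Injective u) (hu₀ : Function.Injective u₀) {a : Fin h} {i : Fin r} (hia : a ∈ u i)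
    (hr₀ : Set.range u₀ = {S | S ∈ Set.range u ∧ a ∉ S}) : r₀ < r := by
  classical
  have hss : Finset.univ.image u₀ ⊂ Finset.univ.image u := by
    rw [Finset.ssubset_iff_subset_ne]
    refine ⟨?_, ?_⟩
    · intro x hx
      rw [Finset.mem_image] at hx ⊢
      obtain ⟨j, _, rfl⟩ := hx
      have hj : u₀ j ∈ Set.range u₀ := ⟨j, rfl⟩
      rw [hr₀] at hj
      obtain ⟨k, hk⟩ := hj.1
      exact ⟨k, Finset.mem_univ _, hk⟩
    · intro heq
      have hui : u i ∈ Finset.univ.image u₀ := by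
        rw [heq, Finset.mem_image]; exact ⟨i, Finset.mem_univ _, rfl⟩
      rw [Finset.mem_image] at hui
      obtain ⟨j, _, hj⟩ := hui
      have hj' : u₀ j ∈ Set.range u₀ := ⟨j, rfl⟩
      rw [hr₀] at hj'
      exact hj'.2 (hj ▸ hia)
  have := Finset.card_lt_card hss
  rwa [card_image_univ' hu₀, card_image_univ' hu] at this

/-- The deletion complex is again a lower set. -/
private theorem lowerSet_vertexDeletion {r r₀ : ℕ} {u : Fin r → Finset (Fin h)} {u₀ : Fin r₀ → Finset (Fin h)}
    (hlu : IsLowerSet (Set.range u)) (a : Fin h)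
    (hr₀ : Set.range u₀ = {S | S ∈ Set.range u ∧ a ∉ S}) : IsLowerSet (Set.range u₀) := by
  rw [hr₀]
  intro S T hTS hS
  exact ⟨hlu hTS hS.1, fun haT => hS.2 (hTS haT)⟩

/-- If no row contains a vertex, an injective family has at most one row (the empty one). -/
private theorem le_one_of_forall_not_mem {r : ℕ} {u : Fin r → Finset (Fin h)} (hu : Function.Injective u)
    (hex : ∀ (i : Fin r) (a : Fin h), a ∉ u i) : r ≤ 1 := by
  by_contra hr
  push Not at hr
  have h01 : u ⟨0, by omega⟩ = u ⟨1, by omega⟩ := by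
    rw [Finset.eq_empty_iff_forall_notMem.mpr (hex _), Finset.eq_empty_iff_forall_notMem.mpr (hex _)]
  have := hu h01
  simp [Fin.ext_iff] at this

end Induction

/-- **The vertex step implies profile-1 symbolic non-vanishing on EVERY injective simplicial pair, every `h`** (induction on `r`:
`r ≤ 1` is the landed `stub_base`; otherwise some row has a vertex `a`, the vertex step applies, and its hypothesis is the induction
hypothesis on the strictly smaller deletion pairs). -/
theorem symbolicDet_one_ne_zero_of_vertexStep'
    (H : ∀ (h r : ℕ) (u w : Fin r → Finset (Fin h)), Function.Injective u → Function.Injective w →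
      IsLowerSet (Set.range u) → IsLowerSet (Set.range w) →
      ∀ (a : Fin h), (∃ i, a ∈ u i) →
        (∀ (r₀ : ℕ) (u₀ w₀ : Fin r₀ → Finset (Fin h)), Function.Injective u₀ → Function.Injective w₀ →
            Set.range u₀ = {S | S ∈ Set.range u ∧ a ∉ S} → Set.range w₀ ⊆ Set.range w → IsLowerSet (Set.range w₀) →
            symbolicDet 1 h r₀ u₀ w₀ ≠ 0) →
        symbolicDet 1 h r u w ≠ 0) (h : ℕ) :
    ∀ (r : ℕ) (u w : Fin r → Finset (Fin h)), Function.Injective u → Function.Injective w →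
      IsLowerSet (Set.range u) → IsLowerSet (Set.range w) → symbolicDet 1 h r u w ≠ 0 := by
  intro r
  induction r using Nat.strong_induction_on with
  | _ r ih =>
    intro u w hu hw hlu hlw
    by_cases hex : ∃ (i : Fin r) (a : Fin h), a ∈ u i
    · obtain ⟨i, a, hia⟩ := hex
      refine H h r u w hu hw hlu hlw a ⟨i, hia⟩ ?_
      intro r₀ u₀ w₀ hu₀ hw₀ hru₀ _hrw₀ hlw₀
      exact ih r₀ (lt_of_vertexDeletion hu hu₀ hia hru₀) u₀ w₀ hu₀ hw₀ (lowerSet_vertexDeletion hlu a hru₀) hlw₀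
    · push Not at hex
      exact stub_base 1 h r u w hu hw hlu hlw (le_one_of_forall_not_mem hu hex)

/-- **The vertex step closes the line's stub `Stmt.stub_symbolicNonvanishing`** (with `s = 1`, `h₀ = 0`; any larger profile by
`symbolicDet_ne_zero_mono`). Composition offered to the planner: `Stmt.stub_vertexStep → Stmt.stub_symbolicNonvanishing → (item)`. -/
theorem stub_symbolicNonvanishing_of_vertexStep'
    (H : ∀ (h r : ℕ) (u w : Fin r → Finset (Fin h)), Function.Injective u → Function.Injective w →
      IsLowerSet (Set.range u) → IsLowerSet (Set.range w) →
      ∀ (a : Fin h), (∃ i, a ∈ u i) →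
        (∀ (r₀ : ℕ) (u₀ w₀ : Fin r₀ → Finset (Fin h)), Function.Injective u₀ → Function.Injective w₀ →
            Set.range u₀ = {S | S ∈ Set.range u ∧ a ∉ S} → Set.range w₀ ⊆ Set.range w → IsLowerSet (Set.range w₀) →
            symbolicDet 1 h r₀ u₀ w₀ ≠ 0) →
        symbolicDet 1 h r u w ≠ 0) : Stmt.stub_symbolicNonvanishing :=
  ⟨1, 0, fun h _ r u w hu hw hlu hlw => symbolicDet_one_ne_zero_of_vertexStep' H h r u w hu hw hlu hlw⟩

/-- The same at any profile `s ≥ 1` (the door 𝔄_s contains 𝔄₁). -/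
theorem symbolicDet_ne_zero_of_vertexStep'
    (H : ∀ (h r : ℕ) (u w : Fin r → Finset (Fin h)), Function.Injective u → Function.Injective w →
      IsLowerSet (Set.range u) → IsLowerSet (Set.range w) →
      ∀ (a : Fin h), (∃ i, a ∈ u i) →
        (∀ (r₀ : ℕ) (u₀ w₀ : Fin r₀ → Finset (Fin h)), Function.Injective u₀ → Function.Injective w₀ →
            Set.range u₀ = {S | S ∈ Set.range u ∧ a ∉ S} → Set.range w₀ ⊆ Set.range w → IsLowerSet (Set.range w₀) →
            symbolicDet 1 h r₀ u₀ w₀ ≠ 0) →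
        symbolicDet 1 h r u w ≠ 0) {s : ℕ} (hs : 1 ≤ s) (h r : ℕ)
    (u w : Fin r → Finset (Fin h)) (hu : Function.Injective u) (hw : Function.Injective w)
    (hlu : IsLowerSet (Set.range u)) (hlw : IsLowerSet (Set.range w)) : symbolicDet s h r u w ≠ 0 :=
  symbolicDet_ne_zero_mono hs (symbolicDet_one_ne_zero_of_vertexStep' H h r u w hu hw hlu hlw)

end

end Summit.ValiantsHypothesis.ValiantsHypothesis.Theorems.BarrierLever.AnchoredPeeling
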